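import Summits.BirchSwinnertonDyer.BirchSwinnertonDyer.Theorems.SignedLowerHalvesKobayashiLowerHalfSemistablePW21NonEisensteinAnyPrime
import Literature.NumberTheory.Automorphic.ShimuraCurveRibetTakahashiPairwiseEisensteinProofs
import Literature.NumberTheory.EllipticCurves.RibetTakahashiDefinitePrimeEisenstein
import Literature.NumberTheory.EllipticCurves.TakahashiDegreeFormulaProofs
import Literature.NumberTheory.EllipticCurves.BrandtModuleJLSelfPairing
import HarnessLib

/-!
# Takahashi 2001, Theorem 2.7 (`p ∤ i_r` for `E[p]` irreducible) FROM THE BRANDT DICTIONARY, at every prime `p` and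
# every prime `r ∥ N`: the named fact `takahashi2001_thm_2_3_2_7_of_coprime` rests on the same input as Thm. 2.3

Route-independent `Theorems` file (cell `b2b-bsdres`, seat `b2b-bsdres-x10b` = class owner X6/X7, gen 42); part 8 of the
Brandt-module series of gens 41–42 (`…PW21*`).
HONEST FRAMING: prove what is provable now; shrink each hard class to its core with data; no claim beyond stated
classes. Nothing about any curve is asserted beyond the displayed hypotheses and NO summit statement is proved here;
BSD is not proved by any of this.

The tree carries two named facts on the definite Ribet–Takahashi formula at a prime `r ∥ N = M r` (`M` arbitrary):
`takahashi2001_thm_2_3_of_coprime` (`δ i_r = ξ_S j_r`, `i_r j_r = c_r`, `i_r ∣ ξ_S`), DISCHARGED from the character-group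
dictionary (`takahashi2001_thm_2_3_of_coprime_of_brandtDictionary`, `ShimuraCurveRibetTakahashiPairwiseEisensteinProofs.lean`,
section hypothesis `hDict`), and `takahashi2001_thm_2_3_2_7_of_coprime` = the same PLUS Thm. 2.7's clause **`p ∤ i_r`
for every prime `p` at which `E[p]` is irreducible**, carrying the binder `5 ≤ r` because its printed source is Ribet 1990
Thm. 3.12 (the Hecke action on `Φ_r(J₀(Mr))` is Eisenstein, `r ≥ 5`) + Brauer–Nesbitt. It is consumed BY NAME by the X7
toric-period valuation files (`Summits/…/Rank1Residual/Supersingular/X7ToricPeriodValuationPrimeIrreducible.lean`) and by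
line `grossdef5` of crux U5 (`Cruxes/UpperNonSurjFive`). This file proves Thm. 2.7's clause INSIDE THE BRANDT MODULE from
the dictionary ALONE, for every prime `p` and every prime `r`:

* `exists_image_coker_nonEisenstein_of_brandtData` — one curve, one setup, abstract Brandt data (as in the tree's
  `exists_image_coker_eisenstein_of_brandtData`): Takahashi's `(i_r, j_r)` with `0 < i`, `i j = c_r`, `i ∣ ξ_S`,
  `δ i = ξ_S j`, AND `p ∤ i` for every prime `p` with `E[p]` irreducible. Proof: `i` generates `{u_J(g, y) : y ∈ X}`
  (Lemma 2.2, `Takahashi2001.exists_index_formula`), `X ⊇ ℤ[Cls O]⁰`, and `not_dvd_generator_range_pairing_of_irreducible_anyPrime`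
  (part 7: the mod-`p` Eisenstein criterion at every prime — `p ≥ 5` by the unit count `w_c ∣ 12`, `p = 3` / `p = 2`
  by the fixed-point-free action of a unit of order `3` / `4` on the Brandt sets).
* `takahashi2001_thm_2_3_2_7_of_coprime_of_brandtDictionary` — **the named fact from the dictionary** (hypothesis
  `hDict` VERBATIM as in the sibling discharge of Thm. 2.3; the binder `5 ≤ r` of the fact is not used).
* `exists_ij_not_dvd_of_brandtDictionary` — the same conclusion for EVERY prime `r` (no `5 ≤ r`), and
  `padicValNat_modularDegree_eq_xi_add_of_irreducible_of_brandtDictionary` — `ord_p δ = ord_p ξ_S + ord_p c_r` for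
  `E[p]` irreducible at every prime `r ∥ N`, modulo `hDict` (the tree's `padicValNat_modularDegree_eq_xi_add_of_irreducible`
  has `5 ≤ r`, modulo `hT27`).

So the two Takahashi binders rest on ONE geometric input (Ribet 1990 §3 / Conrad–Stein / Kohel / multiplicity one: the
dictionary), and Ribet's Thm. 3.12 is not needed for `Φ_r(J₀(Mr)) → Φ_r(E)` being zero on `p`-primary parts when `E[p]`
is irreducible — at ANY `r`, including `r ∈ {2, 3}` (Edixhoven's range) — granted the dictionary.

## References

* [Takahashi2001] S. Takahashi, J. Number Theory 90 (2001), Lemma 2.2, Thm. 2.3 (p. 79), Thm. 2.7 (p. 80), p. 84.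
* [Ribet1990] K. Ribet, Invent. Math. 100 (1990), §3 Prop. 3.1, Thm. 3.12.
* [PollackWeston2011] R. Pollack, T. Weston, Compos. Math. 147 (2011), Props. 6.3–6.6.
* [ConradStein2001] Math. Res. Lett. 8 (2001), Thm. 6.1, Prop. 6.5, Cor. 6.6; [Kohel2001] Adv. Stud. Pure Math. 30, Thm. 4.3.
-/

noncomputable section

open scoped BigOperators Matrix

-- D-0017: single-problem summit, the namespace repeats the problem name by design.
set_option linter.dupNamespace false

namespace Summit.BirchSwinnertonDyer.BirchSwinnertonDyer.Theorems.Takahashi27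

open Literature.NumberTheory.Automorphic Literature.NumberTheory.EllipticCurves
  Literature.NumberTheory.EllipticCurves.ModularForms
open Literature.NumberTheory.EllipticCurves.Takahashi2001 (exists_index_formula exists_eq_span_of_finrank_eq_one)
open Summit.BirchSwinnertonDyer.BirchSwinnertonDyer.Theorems.PollackWestonLemma21
  (not_dvd_generator_range_pairing_of_irreducible_anyPrime)

/-- **Takahashi 2001, Thm. 2.3 with Thm. 2.7's clause, for one curve and one setup, from Brandt data.** As the tree's
`exists_image_coker_eisenstein_of_brandtData` (a sublattice `X ⊆ ℤ^{Cls O}` — the character group `X_r(J₀(Mr))` — maps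
`pb = π^*`, `pf = π_*` adjoint for Gross's pairing and `u_E(a, b) = c_r a b`, `π_* π^* = δ`, `π_*` onto, `X` saturated
and containing every degree-zero vector, the `a(W)`-eigen-lattice of rank one containing `π^* 1`). Conclusion:
Takahashi's `(i_r, j_r)` — `0 < i`, `i j = ord_r Δ_min(W)`, `i ∣ ξ`, `δ i = ξ j` — AND **`p ∤ i` for every prime `p` at
which `ρ̄_{E,p}` is irreducible**: `i` generates `{u_J(g, y) : y ∈ X}` (Lemma 2.2), so `i ∣ ⟨g, y⟩` for every degree-zero
`y`, and `not_dvd_generator_range_pairing_of_irreducible_anyPrime` (the Brandt Eisenstein criterion at every prime).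
[cite: Takahashi2001, Lemma 2.2, Thm. 2.3 (p. 79), Thm. 2.7 (p. 80), p. 84] [cite: Ribet1990, Prop. 3.1] -/
theorem exists_image_coker_nonEisenstein_of_brandtData (W : WeierstrassCurve ℚ) [W.IsElliptic]
    (M r : ℕ) [NeZero (M * r)] (hr : r.Prime) (hN : W.conductorNorm ℤ = M * r)
    (P : ModularParametrizationData W (M * r)) (S : Brandt.XiSetup M r)
    [Fintype (Brandt.ClassSet S.O)] (X : Submodule ℤ (Brandt.ClassSet S.O → ℤ))
    (pb : ℤ →ₗ[ℤ] X) (pf : X →ₗ[ℤ] ℤ)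
    (hadj : ∀ (a : ℤ) (y : X),
      ∑ i, (Brandt.weight S.O i : ℤ) * (pb a : Brandt.ClassSet S.O → ℤ) i *
          (y : Brandt.ClassSet S.O → ℤ) i =
        ((W.minimalDiscriminantNorm ℤ).factorization r : ℤ) * a * pf y)
    (hδ : ∀ a : ℤ, pf (pb a) = (P.modularDegree : ℤ) * a) (hsurj : Function.Surjective pf)
    (hXsat : ∀ (m : ℤ) (v : Brandt.ClassSet S.O → ℤ), m ≠ 0 → m • v ∈ X → v ∈ X)
    (hX0 : ∀ v : Brandt.ClassSet S.O → ℤ, ∑ i, v i = 0 → v ∈ X)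
    (hrank : Module.finrank ℤ
      (Brandt.eigenLattice (M * r) (Brandt.matrix S.O) (fun n => W.LFunction n)) = 1)
    (hmem : (pb 1 : Brandt.ClassSet S.O → ℤ) ∈
      Brandt.eigenLattice (M * r) (Brandt.matrix S.O) (fun n => W.LFunction n)) :
    ∃ i j : ℕ, 0 < i ∧ i * j = (W.minimalDiscriminantNorm ℤ).factorization r ∧
      i ∣ S.xi (fun n => W.LFunction n) ∧
      P.modularDegree * i = S.xi (fun n => W.LFunction n) * j ∧
      ∀ p : ℕ, p.Prime → W.HasIrreducibleModPGaloisRep p → ¬ p ∣ i := by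
  classical
  set c : ℕ := (W.minimalDiscriminantNorm ℤ).factorization r with hc_def
  set δ : ℕ := P.modularDegree with hδ_def
  -- the generator `g₀` of the eigen-line; `π^* 1 = j g₀`, `j ≠ 0`, `g₀ ∈ X`
  obtain ⟨g₀, hg₀, hL⟩ := exists_eq_span_of_finrank_eq_one hrank
  rw [hL] at hmem
  obtain ⟨j, hj⟩ := Submodule.mem_span_singleton.mp hmem
  have hδ0 : 0 < δ := P.deg_pos
  have hj0 : j ≠ 0 := by
    rintro rfl
    have h0 : pb 1 = 0 := Subtype.ext (by rw [← hj, zero_smul]; rfl)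
    have h1 := hδ 1
    rw [h0, map_zero, mul_one] at h1
    exact hδ0.ne' (by exact_mod_cast h1.symm)
  have hg₀X : g₀ ∈ X := hXsat j g₀ hj0 (by rw [hj]; exact (pb 1).2)
  obtain ⟨g, rfl⟩ : ∃ g : X, (g : Brandt.ClassSet S.O → ℤ) = g₀ := ⟨⟨g₀, hg₀X⟩, rfl⟩
  have hg : pb 1 = j • g := Subtype.ext (by rw [Submodule.coe_smul]; exact hj.symm)
  -- `c_r = ord_r Δ_min > 0`
  have hc0 : 0 < c := by
    have hfin := WeierstrassCurve.finite_setOf_ordMinimalDiscriminant_ne_zero_holds (A := ℤ) W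
    have hdvd : W.conductorNorm ℤ ∣ W.minimalDiscriminantNorm ℤ :=
      W.conductorNorm_dvd_minimalDiscriminantNorm hfin
    have hpos : 0 < W.minimalDiscriminantNorm ℤ := W.minimalDiscriminantNorm_pos_holds
    have hrd : r ∣ W.minimalDiscriminantNorm ℤ :=
      dvd_trans ⟨M, by rw [hN, mul_comm]⟩ hdvd
    exact hr.factorization_pos_of_dvd hpos.ne' hrd
  -- Gross's pairing on `ℤ^{Cls O}` and its restriction `u_J` to `X`; `u_E(a, b) = c a b` on `ℤ`
  let B : (Brandt.ClassSet S.O → ℤ) →ₗ[ℤ] (Brandt.ClassSet S.O → ℤ) →ₗ[ℤ] ℤ :=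
    LinearMap.mk₂ ℤ (fun x y => ∑ i, (Brandt.weight S.O i : ℤ) * x i * y i)
      (fun x₁ x₂ y => by
        simp only [Pi.add_apply, mul_add, add_mul, Finset.sum_add_distrib])
      (fun a x y => by
        simp only [Pi.smul_apply, smul_eq_mul, Finset.mul_sum]
        exact Finset.sum_congr rfl fun i _ => by ring)
      (fun x y₁ y₂ => by
        simp only [Pi.add_apply, mul_add, Finset.sum_add_distrib])
      (fun a x y => by
        simp only [Pi.smul_apply, smul_eq_mul, Finset.mul_sum]
        exact Finset.sum_congr rfl fun i _ => by ring)
  have hB : ∀ x y : Brandt.ClassSet S.O → ℤ, B x y = ∑ i, (Brandt.weight S.O i : ℤ) * x i * y i :=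
    fun x y => rfl
  let uJ : X →ₗ[ℤ] X →ₗ[ℤ] ℤ := B.compl₁₂ X.subtype X.subtype
  have huJ : ∀ x y : X, uJ x y = ∑ i, (Brandt.weight S.O i : ℤ) * (x : Brandt.ClassSet S.O → ℤ) i *
      (y : Brandt.ClassSet S.O → ℤ) i := fun x y => by
    simp only [uJ, LinearMap.compl₁₂_apply, Submodule.coe_subtype, hB]
  let uE : ℤ →ₗ[ℤ] ℤ →ₗ[ℤ] ℤ :=
    LinearMap.mk₂ ℤ (fun a b => (c : ℤ) * a * b) (fun a₁ a₂ b => by ring)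
      (fun m a b => by simp only [smul_eq_mul]; ring) (fun a b₁ b₂ => by ring)
      (fun m a b => by simp only [smul_eq_mul]; ring)
  have huE : ∀ a b : ℤ, uE a b = (c : ℤ) * a * b := fun a b => rfl
  have hadj' : ∀ (a : ℤ) (y : X), uJ (pb a) y = uE a (pf y) := fun a y => by
    rw [huJ, huE, ← hadj a y]
  have hδ' : ∀ a : ℤ, pf (pb a) = (δ : ℤ) • a := fun a => by rw [hδ a, smul_eq_mul]
  have hgen : ∀ x : ℤ, ∃ m : ℤ, m • (1 : ℤ) = x := fun x => ⟨x, by rw [smul_eq_mul, mul_one]⟩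
  have hc' : 0 < uE 1 1 := by rw [huE, mul_one, mul_one]; exact_mod_cast hc0
  have hc'' : uE 1 1 = (c : ℤ) := by rw [huE, mul_one, mul_one]
  -- Lemma 2.2 / Thm. 2.3 with the ideal `(i) = {u_J(g, y)}` kept
  obtain ⟨i, hi, hI, hij, hih, hδi⟩ := exists_index_formula uJ uE pb pf hadj' hδ' hsurj hgen hc' hg
  -- `h_r = u_J(g, g) = S.xi`
  have hxi : S.xi (fun n => W.LFunction n) =
      ∑ i, Brandt.weight S.O i * ((g : Brandt.ClassSet S.O → ℤ) i).natAbs ^ 2 :=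
    xi_lFunction_eq_sum W S hg₀ hL
  have hh : uJ g g = (S.xi (fun n => W.LFunction n) : ℤ) := by
    rw [hxi, huJ, Nat.cast_sum]
    exact Finset.sum_congr rfl fun i _ => by push_cast; rw [sq_abs]; ring
  -- `i` divides every pairing `⟨g, y⟩`, `y ∈ X`
  have hiy : ∀ y ∈ X, (i : ℤ) ∣ ∑ c₁, (Brandt.weight S.O c₁ : ℤ) * (g : Brandt.ClassSet S.O → ℤ) c₁ * y c₁ := by
    intro y hy
    have hmemI : uJ g ⟨y, hy⟩ ∈ LinearMap.range (uJ g) := LinearMap.mem_range_self _ _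
    rw [hI, Ideal.mem_span_singleton] at hmemI
    rwa [huJ] at hmemI
  -- Thm. 2.7's clause, at every prime `p`
  have h27 : ∀ p : ℕ, p.Prime → W.HasIrreducibleModPGaloisRep p → ¬ p ∣ i := by
    intro p hp hirr hpi
    haveI : Fact p.Prime := ⟨hp⟩
    exact not_dvd_generator_range_pairing_of_irreducible_anyPrime W hN hirr S X hX0 hg₀ hL hiy
      (Int.natCast_dvd_natCast.mpr hpi)
  refine ⟨i, j.natAbs, hi, ?_, ?_, ?_, h27⟩
  · have h1 : ((i * j.natAbs : ℕ) : ℤ) = (c : ℤ) := by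
      rw [Nat.cast_mul, Int.natCast_natAbs, hij, hc'']
    exact_mod_cast h1
  · rw [hh] at hih
    exact_mod_cast hih
  · have h1 : ((δ * i : ℕ) : ℤ) = ((S.xi (fun n => W.LFunction n) * j.natAbs : ℕ) : ℤ) := by
      rw [Nat.cast_mul, Nat.cast_mul, Int.natCast_natAbs, hδi, hh]
    exact_mod_cast h1

/-- **Takahashi's `(i_r, j_r)` with `p ∤ i_r` (`E[p]` irreducible), from the character-group dictionary, at EVERY prime
`r ∥ N`** (no `5 ≤ r`): for `W` of conductor `M r` (`r` prime, `gcd(M, r) = 1`, `M` arbitrary), a datum `P` at level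
`M r` of minimal degree among the data of conductor-`M r` curves with the same newform, every Brandt setup `S` of type
`(M, r)` and every prime `p` with `ρ̄_{E,p}` irreducible. The hypothesis `hDict` is VERBATIM the section hypothesis of
`takahashi2001_thm_2_3_of_coprime_of_brandtDictionary`. [cite: Takahashi2001, Thm. 2.3 (p. 79), Thm. 2.7 (p. 80), p. 84] -/
theorem exists_ij_not_dvd_of_brandtDictionary
    (hDict : ∀ (W : WeierstrassCurve ℚ) [W.IsElliptic] (M r : ℕ) [NeZero (M * r)],
      r.Prime → M.Coprime r → W.conductorNorm ℤ = M * r →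
      ∀ P : ModularParametrizationData W (M * r),
        (∀ (W' : WeierstrassCurve ℚ) [W'.IsElliptic], W'.conductorNorm ℤ = M * r →
            ∀ P' : ModularParametrizationData W' (M * r),
            P'.f = P.f → P.modularDegree ≤ P'.modularDegree) →
        ∀ (S : Brandt.XiSetup M r) [Fintype (Brandt.ClassSet S.O)],
          ∃ (X : Submodule ℤ (Brandt.ClassSet S.O → ℤ)) (pb : ℤ →ₗ[ℤ] X) (pf : X →ₗ[ℤ] ℤ),
            (∀ (a : ℤ) (y : X),
                ∑ i, (Brandt.weight S.O i : ℤ) * (pb a : Brandt.ClassSet S.O → ℤ) i *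
                    (y : Brandt.ClassSet S.O → ℤ) i =
                  ((W.minimalDiscriminantNorm ℤ).factorization r : ℤ) * a * pf y) ∧
            (∀ a : ℤ, pf (pb a) = (P.modularDegree : ℤ) * a) ∧
            Function.Surjective pf ∧
            (∀ (m : ℤ) (v : Brandt.ClassSet S.O → ℤ), m ≠ 0 → m • v ∈ X → v ∈ X) ∧
            (∀ v : Brandt.ClassSet S.O → ℤ, ∑ i, v i = 0 → v ∈ X) ∧
            Module.finrank ℤ
                (Brandt.eigenLattice (M * r) (Brandt.matrix S.O) (fun n => W.LFunction n)) = 1 ∧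
            (pb 1 : Brandt.ClassSet S.O → ℤ) ∈
              Brandt.eigenLattice (M * r) (Brandt.matrix S.O) (fun n => W.LFunction n))
    (W : WeierstrassCurve ℚ) [W.IsElliptic] (M r : ℕ) [NeZero (M * r)] (hr : r.Prime)
    (hMr : M.Coprime r) (hN : W.conductorNorm ℤ = M * r) (P : ModularParametrizationData W (M * r))
    (hmin : ∀ (W' : WeierstrassCurve ℚ) [W'.IsElliptic], W'.conductorNorm ℤ = M * r →
      ∀ P' : ModularParametrizationData W' (M * r), P'.f = P.f → P.modularDegree ≤ P'.modularDegree)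
    (S : Brandt.XiSetup M r) {p : ℕ} (hp : p.Prime) (hirr : W.HasIrreducibleModPGaloisRep p) :
    ∃ i j : ℕ, 0 < i ∧ ¬ p ∣ i ∧ i * j = (W.minimalDiscriminantNorm ℤ).factorization r ∧
      i ∣ S.xi (fun n => W.LFunction n) ∧
      P.modularDegree * i = S.xi (fun n => W.LFunction n) * j := by
  classical
  letI : Fintype (Brandt.ClassSet S.O) := Fintype.ofFinite _
  obtain ⟨X, pb, pf, hadj, hδ, hsurj, hXsat, hX0, hrank, hmem⟩ := hDict W M r hr hMr hN P hmin S
  obtain ⟨i, j, hi, hij, hiξ, hδi, h27⟩ := exists_image_coker_nonEisenstein_of_brandtData W M r hr hN P S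
    X pb pf hadj hδ hsurj hXsat hX0 hrank hmem
  exact ⟨i, j, hi, h27 p hp hirr, hij, hiξ, hδi⟩

/-- **The named fact `takahashi2001_thm_2_3_2_7_of_coprime` (Takahashi 2001 Thm. 2.3 ∧ Thm. 2.7 at `D = 1`, `r ∥ N`,
`M` arbitrary, `r ≥ 5`) FOLLOWS FROM THE BRANDT DICTIONARY** — the same hypothesis `hDict` under which the tree
discharges `takahashi2001_thm_2_3_of_coprime` (`takahashi2001_thm_2_3_of_coprime_of_brandtDictionary`). Thm. 2.7's
clause `p ∤ i_r` is the Brandt Eisenstein criterion at every prime (`exists_image_coker_nonEisenstein_of_brandtData`);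
the fact's binder `5 ≤ r` (Ribet 1990 Thm. 3.12) is idle on this road.
[cite: Takahashi2001, Thm. 2.3 (p. 79) and Thm. 2.7 (p. 80)] [cite: Ribet1990, Prop. 3.1, Thm. 3.12] -/
theorem takahashi2001_thm_2_3_2_7_of_coprime_of_brandtDictionary
    (hDict : ∀ (W : WeierstrassCurve ℚ) [W.IsElliptic] (M r : ℕ) [NeZero (M * r)],
      r.Prime → M.Coprime r → W.conductorNorm ℤ = M * r →
      ∀ P : ModularParametrizationData W (M * r),
        (∀ (W' : WeierstrassCurve ℚ) [W'.IsElliptic], W'.conductorNorm ℤ = M * r →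
            ∀ P' : ModularParametrizationData W' (M * r),
            P'.f = P.f → P.modularDegree ≤ P'.modularDegree) →
        ∀ (S : Brandt.XiSetup M r) [Fintype (Brandt.ClassSet S.O)],
          ∃ (X : Submodule ℤ (Brandt.ClassSet S.O → ℤ)) (pb : ℤ →ₗ[ℤ] X) (pf : X →ₗ[ℤ] ℤ),
            (∀ (a : ℤ) (y : X),
                ∑ i, (Brandt.weight S.O i : ℤ) * (pb a : Brandt.ClassSet S.O → ℤ) i *
                    (y : Brandt.ClassSet S.O → ℤ) i =
                  ((W.minimalDiscriminantNorm ℤ).factorization r : ℤ) * a * pf y) ∧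
            (∀ a : ℤ, pf (pb a) = (P.modularDegree : ℤ) * a) ∧
            Function.Surjective pf ∧
            (∀ (m : ℤ) (v : Brandt.ClassSet S.O → ℤ), m ≠ 0 → m • v ∈ X → v ∈ X) ∧
            (∀ v : Brandt.ClassSet S.O → ℤ, ∑ i, v i = 0 → v ∈ X) ∧
            Module.finrank ℤ
                (Brandt.eigenLattice (M * r) (Brandt.matrix S.O) (fun n => W.LFunction n)) = 1 ∧
            (pb 1 : Brandt.ClassSet S.O → ℤ) ∈
              Brandt.eigenLattice (M * r) (Brandt.matrix S.O) (fun n => W.LFunction n)) :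
    takahashi2001_thm_2_3_2_7_of_coprime := by
  intro W _ M r _ hr _ hMr hN P hmin S p hp hirr
  exact exists_ij_not_dvd_of_brandtDictionary hDict W M r hr hMr hN P hmin S hp hirr

/-- **`ord_p δ = ord_p ξ_S(E; M, r) + ord_p c_r` for `E[p]` irreducible, at EVERY prime `r ∥ N`, modulo the dictionary**
(the tree's `padicValNat_modularDegree_eq_xi_add_of_irreducible` has `5 ≤ r`, modulo the named fact): read `δ i = ξ j`,
`i j = c_r`, `p ∤ i` `p`-adically. For the `X₀(Mr)`-optimal `W` of conductor `M r` (`r` prime, `gcd(M, r) = 1`, `M`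
arbitrary), a minimal-degree datum `P`, any Brandt setup `S`, any prime `p` with `ρ̄_{E,p}` irreducible.
[cite: Takahashi2001, Thm. 2.3 (p. 79) and Thm. 2.7 (p. 80)] [cite: PollackWeston2011, Prop. 6.6] -/
theorem padicValNat_modularDegree_eq_xi_add_of_irreducible_of_brandtDictionary
    (hDict : ∀ (W : WeierstrassCurve ℚ) [W.IsElliptic] (M r : ℕ) [NeZero (M * r)],
      r.Prime → M.Coprime r → W.conductorNorm ℤ = M * r →
      ∀ P : ModularParametrizationData W (M * r),
        (∀ (W' : WeierstrassCurve ℚ) [W'.IsElliptic], W'.conductorNorm ℤ = M * r →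
            ∀ P' : ModularParametrizationData W' (M * r),
            P'.f = P.f → P.modularDegree ≤ P'.modularDegree) →
        ∀ (S : Brandt.XiSetup M r) [Fintype (Brandt.ClassSet S.O)],
          ∃ (X : Submodule ℤ (Brandt.ClassSet S.O → ℤ)) (pb : ℤ →ₗ[ℤ] X) (pf : X →ₗ[ℤ] ℤ),
            (∀ (a : ℤ) (y : X),
                ∑ i, (Brandt.weight S.O i : ℤ) * (pb a : Brandt.ClassSet S.O → ℤ) i *
                    (y : Brandt.ClassSet S.O → ℤ) i =
                  ((W.minimalDiscriminantNorm ℤ).factorization r : ℤ) * a * pf y) ∧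
            (∀ a : ℤ, pf (pb a) = (P.modularDegree : ℤ) * a) ∧
            Function.Surjective pf ∧
            (∀ (m : ℤ) (v : Brandt.ClassSet S.O → ℤ), m ≠ 0 → m • v ∈ X → v ∈ X) ∧
            (∀ v : Brandt.ClassSet S.O → ℤ, ∑ i, v i = 0 → v ∈ X) ∧
            Module.finrank ℤ
                (Brandt.eigenLattice (M * r) (Brandt.matrix S.O) (fun n => W.LFunction n)) = 1 ∧
            (pb 1 : Brandt.ClassSet S.O → ℤ) ∈
              Brandt.eigenLattice (M * r) (Brandt.matrix S.O) (fun n => W.LFunction n))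
    (W : WeierstrassCurve ℚ) [W.IsElliptic] (M r : ℕ) [NeZero (M * r)] (hr : r.Prime)
    (hMr : M.Coprime r) (hN : W.conductorNorm ℤ = M * r) (P : ModularParametrizationData W (M * r))
    (hP : ∀ (W' : WeierstrassCurve ℚ) [W'.IsElliptic], W'.conductorNorm ℤ = M * r →
      ∀ P' : ModularParametrizationData W' (M * r), P'.f = P.f → P.modularDegree ≤ P'.modularDegree)
    {p : ℕ} [Fact p.Prime] (hirr : W.HasIrreducibleModPGaloisRep p) (S : Brandt.XiSetup M r) :
    padicValNat p P.modularDegree =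
      padicValNat p (S.xi fun n => W.LFunction n) +
        padicValNat p ((W.minimalDiscriminantNorm ℤ).factorization r) := by
  have hp : p.Prime := Fact.out
  obtain ⟨i, j, hi, hpi, hij, -, hδ⟩ := exists_ij_not_dvd_of_brandtDictionary hDict W M r hr hMr hN P hP S hp hirr
  have hδ0 : P.modularDegree ≠ 0 := P.deg_pos.ne'
  have hδi : P.modularDegree * i ≠ 0 := mul_ne_zero hδ0 hi.ne'
  have hj0 : j ≠ 0 := by
    rintro rfl
    exact hδi (by rw [hδ, mul_zero])
  have hξ0 : (S.xi fun n => W.LFunction n) ≠ 0 := by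
    intro h0
    exact hδi (by rw [hδ, h0, zero_mul])
  have h := congrArg (padicValNat p) hδ
  rw [padicValNat.mul hδ0 hi.ne', padicValNat.mul hξ0 hj0, padicValNat.eq_zero_of_not_dvd hpi,
    add_zero] at h
  rw [h, ← hij, padicValNat.mul hi.ne' hj0, padicValNat.eq_zero_of_not_dvd hpi, zero_add]

end Summit.BirchSwinnertonDyer.BirchSwinnertonDyer.Theorems.Takahashi27

end
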